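import Summits.BirchSwinnertonDyer.BirchSwinnertonDyer.Theorems.PrintCFramAcDescentThreeSplitOrbit
import HarnessLib

/-!
# The REGIME-FREE `Λ^ac`-level elliptic-unit main conjecture at the ramified `3` over the
# `End_K(E_K)`-orbit span — (A𝒪)ᴬᴸᴸ, with the proved weakening to the regime-N piece (A𝒪)
# (cell `bsd-print-cfram`, D-0131 (2) PRINT tier, prover seat p2 gen 3; companion of
# `PrintCFramAcDescentThreeSplitOrbit.lean` (p570848); `--supports stmt-BirchSwinnertonDyer-21353`)

NOTHING is asserted: one `@[conjecture]` `Prop` per curve (plus slice form) and two PROVED weakenings.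

WHY. The T-package of the route (ty2 gen 3: items-to-be r6 `EllipticUnitIMCThreeAll` / r7
`BottomClassIndexLawThreeT`, PLAN v5 §4) wants ONE main-conjecture statement valid on ALL 919 classes of
the `p = 3` slice (regimes N, V, T alike) and per-regime LAWS carrying the displayed defects. At
`Λ^ac`-LEVEL the identity `char_Λ(𝒮^ac_rel ⧸ Λ_𝒪·z^ac) = char_Λ(X^ac_str)` HAS NO BOTTOM LAYER: no torsion
of `S_rel(K)` (`= E(K)[3^∞]`, order `d₀ ∈ {3, 9}` on the 178 T_cube classes), no `𝔭`-local `H⁰`-term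
(`E(K_{∞,𝔭})[3^∞]/E(K_∞)[3^∞]`, regime T) and no control cokernel (`#X[T]`) enter it — they all live in
the `T = 0` READING, where the T-law displays them. So the regime-free carrier that is the SAME
statement on N, V and T is the `Λ`-level one: this file types it, (A𝒪)ᴬᴸᴸ = p570848's (A𝒪) with the
three regime-N binder lines ((A𝔭)₃ for `W`, `W'`; (Av)₃) DELETED and everything else VERBATIM (frame,
`r_an = 1`, `h_K = 1`, `𝔭` unique, `(Φ, η)` = the defining properties of `η_E` at `3`, JLK's
two-variable identity for `η` as antecedent, anticyclotomic `κ` with generator `γ`; conclusion: SOME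
pinned datum with, for EVERY relaxed `Λ`-adic datum `𝒮`, `Λ`-torsion of `𝒮.S ⧸ endOrbitSpan 𝒮 D.z` and
of `X`, and equality of their `Λ`-characteristic ideals). PRINT STATUS: on N ∪ V = [BKNO] Prop. 3.7 +
Thm. 3.14 (2) `⊗ ℚ₃` (PRE; integral (3) excluded at `3 ∣ #μ_K`); on T moreover [BKNO] Assumption 3.1 (1)
FAILS (`E_K(K_𝔭)[3] ≠ 0`, p2 g2 `LocalThreeTorsion…`) — beyond print there. A CANDIDATE text for r6
(planner's call; the alternative r6, ty2's bottom-level `RamifiedCMEllipticUnitIMCAtZpThreeAll`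
«`n₀ + log₃ #X[T] = c` regime-free», reads the identity at `T = 0`, where on T_cube the torsion
`E(K)[3^∞]` of `S_rel(K)` and the local `H⁰`-quotient enter the index `c` — p2 g3 READER'S QUESTION,
HOME/STATUS 2026-08-27T21:19:59Z).

* `AcMainConjectureOrbitAllAtZpThree W` — (A𝒪)ᴬᴸᴸ at a curve; `AcMainConjectureOrbitAllThree` — slice.
* PROVED: `acMainConjectureOrbitAtZpThree_of_all` ((A𝒪)ᴬᴸᴸ ⟹ (A𝒪): the regime-N binders are simply
  not used), `acMainConjectureOrbitThree_of_all` (slice).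

HONEST LIMITS: nothing asserted or closed; the `T = 0` readings on V and T (the twins of (B𝒪) with
displayed defects) are NOT typed here (ty2's T/NV packages own the defect bookkeeping); item 21353,
the regime children and the leaf stay OPEN. «beyond-print theorem»: NO.

References: [BurungaleKobayashiNakamuraOta2026] arXiv:2608.06879v1 §3.2.2, Prop. 3.7, Thm. 3.14,
Assumption 3.1 (1) (pp. 16–24) (claim; preprint); [JohnsonLeungKings2011] §5.4; [NekovarSelmerComplexes]
J. Nekovář, *Selmer complexes*, Astérisque 310 (2006) §6.1, §9.6 (the local `H⁰`-term of the strict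
condition; shape only); tree p570848, p566137, ty2 `X12/O11/RamifiedEllipticUnitMechanismZpThreeT.lean`.
-/

-- the summit namespace `Summit.BirchSwinnertonDyer.BirchSwinnertonDyer` repeats the problem name by design (D-0017)
set_option linter.dupNamespace false

noncomputable section

open scoped Classical

open WeierstrassCurve NumberField IsDedekindDomain Field Module PowerSeries
  Literature.NumberTheory.GaloisRepresentations
  Literature.NumberTheory.EllipticCurves
  Literature.NumberTheory.EllipticCurves.Rank1Residual
  Literature.NumberTheory.EllipticCurves.Rank1Residual.Typed
  Literature.NumberTheory.EllipticCurves.Castella2018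
  Literature.NumberTheory.EllipticCurves.BurungaleKobayashiNakamuraOta2026
  Literature.NumberTheory.EllipticCurves.KellerYin2024
  Literature.NumberTheory.ComplexMultiplication.EllipticUnits
  Literature.NumberTheory.ComplexMultiplication.EllipticUnits.JohnsonLeungKings2011
  Literature.NumberTheory.NumberFields
  Summit.BirchSwinnertonDyer.Rank1Residual.Additive
  Summit.BirchSwinnertonDyer.Rank1Residual.X12.O11
  Summit.BirchSwinnertonDyer.BirchSwinnertonDyer.Theorems.PrintCFram.AcDescentThreeSplit

namespace Summit.BirchSwinnertonDyer.BirchSwinnertonDyer.Theorems.PrintCFram.AcDescentThreeOrbit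

variable (W : WeierstrassCurve ℚ) [W.IsElliptic] [W.IsGloballyMinimal]

/-! ## §1 (A𝒪)ᴬᴸᴸ at a curve `W` of the `p = 3` slice -/

/-- **(A𝒪)ᴬᴸᴸ — the REGIME-FREE anticyclotomic elliptic-unit MAIN CONJECTURE at `Λ^ac`-level, at the
ramified `3`, RELATIVE to JLK's two-variable identity for `η_E`, over the ORBIT SPAN `Λ_𝒪 · z^ac`**
(`@[conjecture]`, NOTHING asserted): p570848's `AcMainConjectureOrbitAtZpThree W` with the regime-N
binders (A𝔭)₃ (for `W`, `W'`) and (Av)₃ DELETED — binders: `3`-frame of analytic rank one, `h_K = 1`,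
`𝔭` the unique prime above `3`, `(Φ, η)` with the defining properties of `η_E` at `3`, JLK's identity
for `η` (antecedent), anticyclotomic `κ` with generator `γ`; conclusion: SOME pinned datum
`(ι, φ, Ω ≠ 0, 𝓔, D)` (`L(φ, s) = L(W, s)`) such that for EVERY relaxed `Λ^ac`-adic datum `𝒮`,
`𝒮.S ⧸ endOrbitSpan 𝒮 D.z` and `X = XAc (W_K) 3 κ 𝔭 ∅ γ` are `Λ`-torsion with equal `Λ`-characteristic
ideals. No bottom layer, hence the same statement on regimes N, V, T. PRE `⊗ ℚ₃` on N ∪ V ([BKNO]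
Thm. 3.14 (2)); beyond print integrally at `3` and on T (Assumption 3.1 (1) fails). OPEN. **ERRATUM (cell
referee R0.28, ty2 g4 (3)):** `X = XAc (W_K) 3 κ 𝔭 ∅ γ` is the MINIMAL strict dual; the form that
descends from the two-variable identity is the GREENBERG one (`char X_Gr = char X_min · (3)^{t_cs}`,
Pollack–Weston 2011 §3), so on the 468/919 classes with `t_cs ≥ 1` (ty3 PART I) this identity is short
by `(3)^{t_cs}` in intent; SUPERSEDED as the r6′ text by `AcMainConjectureOrbitGrAtZpThree` /
`AcMainConjectureOrbitGrThree` (`PrintCFramAcDescentThreeOrbitGr.lean`, line «orbit-imc» on item 23006).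
[cite: BurungaleKobayashiNakamuraOta2026, Prop. 3.7 (2)–(4), Thm. 3.14 (2)/(3), Assumption 3.1 (1) (arXiv:2608.06879v1 pp. 16, 19–24) (claim; preprint; shape only)]
[cite: JohnsonLeungKings2011, §5.4 (arXiv:0804.2828 p0016:L19–26) (the antecedent; shape only)] -/
@[conjecture] def AcMainConjectureOrbitAllAtZpThree : Prop :=
  ∀ (K : Type) [Field K] [NumberField K] (𝔭 : HeightOneSpectrum (𝓞 K))
    (W' : WeierstrassCurve ℚ) [W'.IsElliptic] [W'.IsGloballyMinimal] (C : VariableChange ℚ),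
    IsFrameThree W K 𝔭 W' C → W.analyticRank = 1 →
    NumberField.classNumber K = 1 →
    (∀ w : HeightOneSpectrum (𝓞 K), ((3 : ℕ) : 𝓞 K) ∈ w.asIdeal → w = 𝔭) →
    ∀ (Φ : AddSubgroup (W.baseChange K).geomPoints)
      (η : FramedGaloisRep K (padicCoeffIntegers (∅ : Set (PadicAlgCl 3))) 1),
      Nat.card Φ = 3 → Φ ≤ geomTorsion (W.baseChange K) (3 : ℤ) →
      (∀ σ : absoluteGaloisGroup K, ∀ P ∈ Φ, σ • P ∈ Φ) →
      IsResidualPairOver (W.baseChange K) 3 η η → IsTeichmullerLiftOn ∅ Φ η →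
      (∀ σ : absoluteGaloisGroup K, η σ = 1 ↔ ∀ P ∈ Φ, σ • P = P) →
      (∀ {K₀ : IntermediateField K (AlgebraicClosure K)},
        K₀.fixingSubgroup = (η.toMonoidHom.ker).map (absoluteGaloisGroup.toAlgEquiv K).toMonoidHom →
        ∀ {κ₁ κ₂ : ZpExtension K 3} {γ₁ γ₂ : absoluteGaloisGroup K},
          ZpExtension.IsTopGeneratorPair κ₁ κ₂ γ₁ γ₂ → η γ₁ = 1 → η γ₂ = 1 →
          ∀ (ι : K →+* ℂ) (D : ClassGroupDualData₂ κ₁ κ₂ η γ₁ γ₂)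
            (E : UnitIndexData₂ ι K₀ κ₁ κ₂ η γ₁ γ₂),
            Module.Finite (IwasawaAlgebra₂ 3) D.X ∧ Module.IsTorsion (IwasawaAlgebra₂ 3) D.X ∧
              Module.Finite (IwasawaAlgebra₂ 3) E.Q ∧ Module.IsTorsion (IwasawaAlgebra₂ 3) E.Q ∧
              Module.charIdeal (IwasawaAlgebra₂ 3) D.X = Module.charIdeal (IwasawaAlgebra₂ 3) E.Q) →
      ∀ (κ : ZpExtension K 3), κ.IsAnticyclotomic →
        ∀ (γ : absoluteGaloisGroup K) [Fact (κ.IsTopGenerator γ)],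
          ∃ (ι : PadicAlgCl 3 ≃+* ℂ) (φ : HeckeCharacter K) (Ω : ℂ) (𝓔 : AcDualExpSystem W 3 K 𝔭 κ ι)
            (D : EllipticUnitClassData W 3 K 𝔭 κ γ ι φ Ω 𝓔),
            Ω ≠ 0 ∧ (∀ s : ℂ, 3 / 2 < s.re → heckeLFunction φ s = W.LSeries s) ∧
            ∀ (𝒮 : LambdaAdicRelaxedSelmerData (W.baseChange K) κ γ 𝔭),
              Module.IsTorsion (IwasawaAlgebra 3) (𝒮.S ⧸ endOrbitSpan 𝒮 D.z) ∧
              Module.IsTorsion (IwasawaAlgebra 3) (AcSelmer.XAc (W.baseChange K) 3 κ 𝔭 ∅ γ) ∧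
              Module.charIdeal (IwasawaAlgebra 3) (𝒮.S ⧸ endOrbitSpan 𝒮 D.z) =
                Module.charIdeal (IwasawaAlgebra 3) (AcSelmer.XAc (W.baseChange K) 3 κ 𝔭 ∅ γ)

variable {W}

omit [W.IsGloballyMinimal] in
/-- **(A𝒪)ᴬᴸᴸ ⟹ (A𝒪)** (PROVED; the regime-N binders of (A𝒪) are not used). [cite: BurungaleKobayashiNakamuraOta2026, Thm. 3.14 (arXiv:2608.06879v1 p. 24) (claim; preprint; shape only)] -/
theorem acMainConjectureOrbitAtZpThree_of_all (h : AcMainConjectureOrbitAllAtZpThree W) :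
    AcMainConjectureOrbitAtZpThree W := by
  intro K _ _ 𝔭 W' _ _ C hF hr hh huniq Φ η hcard hle hstab hpair hlift hker hJLK κ hκ γ _ _ _ _
  exact h K 𝔭 W' C hF hr hh huniq Φ η hcard hle hstab hpair hlift hker hJLK κ hκ γ

/-! ## §2 Slice form -/

/-- **(A𝒪)ᴬᴸᴸ on the whole `p = 3` slice** (binders of the route's `p = 3` items: `HasCM`,
`CMRamified W 3`, `analyticRank = 1`). `@[conjecture]`, nothing asserted; a candidate text for the
regime-free IMC item r6 (planner's call). [cite: BurungaleKobayashiNakamuraOta2026, Thm. 3.14 (arXiv:2608.06879v1 p. 24) (claim; preprint; shape only)] -/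
@[conjecture] def AcMainConjectureOrbitAllThree : Prop :=
  ∀ (W : WeierstrassCurve ℚ) [W.IsElliptic] [W.IsGloballyMinimal],
    W.HasCM → CMRamified W 3 → W.analyticRank = 1 → AcMainConjectureOrbitAllAtZpThree W

/-- **(A𝒪)ᴬᴸᴸ-slice ⟹ (A𝒪)-slice** (PROVED) — so with p570848's joins, item 21353 ⟸ JLK's named fact ∧
(A𝒪)ᴬᴸᴸ-slice ∧ (B𝒪)-slice. [cite: BurungaleKobayashiNakamuraOta2026, Thm. 3.14 (arXiv:2608.06879v1 p. 24) (claim; preprint; shape only)] -/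
theorem acMainConjectureOrbitThree_of_all (h : AcMainConjectureOrbitAllThree) :
    AcMainConjectureOrbitThree :=
  fun W _ _ hCM hram hr ↦ acMainConjectureOrbitAtZpThree_of_all (h W hCM hram hr)

/-- **Item 21353's body from JLK's named fact ∧ (A𝒪)ᴬᴸᴸ-slice ∧ (B𝒪)-slice** (PROVED: p570848's
`forall_imcAtZpThree_of_sec54_of_orbit` ∘ the slice weakening).
[cite: JohnsonLeungKings2011, §5.4 (arXiv:0804.2828 p0016:L19–26)]
[cite: BurungaleKobayashiNakamuraOta2026, Thm. 3.14 (arXiv:2608.06879v1 p. 24) (claim; preprint)] -/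
theorem forall_imcAtZpThree_of_sec54_of_orbitAll
    (h54 : sec54_charIdeal_classGroup_eq_unitIndex) (hA : AcMainConjectureOrbitAllThree)
    (hB : AcBottomReadingOrbitThree) :
    ∀ (W : WeierstrassCurve ℚ) [W.IsElliptic] [W.IsGloballyMinimal],
      W.HasCM → CMRamified W 3 → W.analyticRank = 1 → RamifiedCMEllipticUnitIMCAtZpThree W :=
  forall_imcAtZpThree_of_sec54_of_orbit h54 (acMainConjectureOrbitThree_of_all hA) hB

end Summit.BirchSwinnertonDyer.BirchSwinnertonDyer.Theorems.PrintCFram.AcDescentThreeOrbit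

end
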